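import Summits.HodgeConjecture.HodgeConjecture.Theorems.F0P3cStCharTSVanDijkHC         -- ★ (F0P3a-p07 g17) «VDW-CORE» files 1–2: `isUnit_iff_apply_ne_zero`, the junction `coe_sqrt_sqrt_unitModulusChar_eq_vanDijkWeight_re`, `exists_unit_mul_det_sq_eq_discr_iff`, `vanDijkWeight_eq_zero_of_not`
import Literature.NumberTheory.Automorphic.LocalRingUnitModulusProduct                  -- ★ `unitModulusChar_localRing_eq_prod` (`‖u‖ = Π_w |u_w|_w`)
import Literature.LinearAlgebra.Matrix.RegularSemisimpleConjClassClosed                 -- ★ `continuous_charpoly_coeff` (the coefficients of `charpoly` are polynomial in the entries)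
import Literature.NumberTheory.Automorphic.LocalFieldHaarBalls                          -- ★ `LocalFieldHaar.continuous_normAbs`
import Literature.NumberTheory.Rogawski1990.Ch12Sec5Defs                              -- ★ TR dictionary: `EllipticData` (the field `DG`)
import Mathlib.RingTheory.Polynomial.Resultant.Basic
import Mathlib.Algebra.Group.Pi.Units
import HarnessLib

/-!
# F0 · P3c · line LH6 «StCharTS» — «DG-FIELD★» (datum road, PLAN S9 D5): the Weyl-discriminant field `𝔇.DG` of the §12.5 datum PINNED to print's
# `D_G(γ) = |Π_{α}(1 − α(γ))|^{1∕2}_{L⁺_v} = ‖discr(charpoly γ) ∕ det(γ)²‖^{1∕4}` — an ∃-FIELD with its three consumer properties, and the field-equation lemmas the ★ slices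
# consume [Rogawski1990, §4.9 p. 54; §12.5 p. 182] [HarishChandra1999AdmissibleDistributions, §17]

Cell `pub/hodgecm-mathlib`, crux H413 = `stmt-HodgeConjecture-24833` (lane `--supports … --as helper`), route HCCMUnconditional; seat F0P3-p02 (g20); datum road of the (S-𝔇)
organ `stub_EllipticPackage` (`Cruxes/H413/Lines/F0_P3c_StCharTSPaydown.lean`), map owner LH6-p01 (g4): PLAN S9 §1 D5 «`DG γ := √√‖discr(charpoly γ) ∕ det(γ)²‖` (0 at
non-regular `γ`)», slice (A) «DG-FIELD★» of 2026-09-02T12:06:38Z (his design: ALL places, no case split, `N(x) := Π_{w∣v} |x_w|_w`).  THEOREMS ONLY (no definition ∕ instance ∕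
notation ∕ named fact ∕ `sorry`); ★-only imports.
HONEST LABEL: HC_CM is proved only modulo the 7 printed citations (2 remaining named inputs: hLiu418 = `stmt-HodgeConjecture-24832`, h413 = `stmt-HodgeConjecture-24833`)
until rung 0 closes; this file closes no organ — it pins one datum field and turns the `D_G`-HYPOTHESES of the ★ slices (S9c `hDGm`∕`hDG` of ★ `F0P3cStCharTSL2dOfHcb`, S13a
`hDGm`∕`hD5` of ★ `F0P3cStCharTSU2OfUpDom`, the same two in ★ `F0P3cStCharTSDatumJunction`) into consequences of it, count-neutral.

THE CLOSED FORM (no definition is introduced; it is spelled inline): for `g ∈ U(Φ₃)(L⁺_v)`, with `R = L ⊗_{L⁺} L⁺_v = Π_{w ∣ v} L_w` and `N(x) := Π_w |x_w|_w` (★ `normAbs`; `N = ‖·‖` =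
★ `unitModulusChar` on units, ★ `unitModulusChar_localRing_eq_prod`; `N(x) = 0` iff some `x_w = 0` iff `x` is not a unit),
  `dg(g) := √√( N(discr(charpoly g)) · (N(det g)²)⁻¹ )` (as a real number).
Print [§4.9 p. 54]: `D_G(γ) = |Π_{α ∈ Φ}(1 − α(γ))|_{L⁺_v}^{1∕2}`; for eigenvalues `λᵢ`, `Π_{i≠j}(1 − λᵢλⱼ⁻¹) = ± discr(charpoly γ) ∕ det(γ)^{N−1}` (`N = 3`) and `|·|_{L⁺_v}^{1∕2} = ‖·‖^{1∕4}`
[HarishChandra1999AdmissibleDistributions §17; the docstring of ★ `normalizedCharacter_locallyBounded`], so `dg = D_G` on `G^r`; off `G^r` the discriminant is a non-unit and `dg = 0` (D5).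
* §1 the closed form: `continuous_dgFormula` (★ `continuous_charpoly_coeff`, Mathlib `discr_of_degree_eq_three`, `Continuous.matrix_det`, ★ `continuous_normAbs`; `N(det g) ≠ 0`),
  `dgFormula_eq_of_unit_rel` («`u·det(g)² = discr ⇒ dg(g) = √√‖u‖`»), `dgFormula_eq_zero_of_not_isUnit_discr`, `exists_unit_rel_iff_isUnit_discr`;
* §2 **`exists_DG_field`** — the ∃-FIELD in the map owner's text: `∃ DG, Measurable DG ∧ (¬ IsUnit discr → DG = 0) ∧ (u·det² = discr → DG = √√‖u‖)` (witness `dg`);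
* §3 at a datum with the FIELD EQUATION `hDG : ∀ g, 𝔇.DG g = dg(g)` (what `⟨𝔇₀, …⟩` with `DG := dg` satisfies by `rfl`): `measurable_DG` (the `hDGm` of S9c∕S13a∕junction), `DG_eq_of_unit_rel`
  (S13a `hD5`) + `DG_coe_torus_eq_of_unit_rel` (its split-torus spelling), `DG_eq_zero_or_exists_unit`, `DG_eq_zero_or_le` (S9c `hDG` verbatim, any `cartanG`), `DG_nonneg`, and
  the TORUS JUNCTION `DG_coe_torus_eq_vanDijkWeight_re` («`𝔇.DG (ι t) = Re Δ(t)` for every `t ∈ M`», `v` non-split; ★ VDW-CORE) — the bridge between the density `D_G` of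
  `WeylIntegrationFormula`∕`innerG` at `T = M` and the density `Δ ∘ ι` of the (TOR) blocks.

## References
* [Rogawski1990] J. D. Rogawski, *Automorphic Representations of Unitary Groups in Three Variables*, Ann. of Math. Stud. 123 (1990): §4.9 p. 54 (`D_G`), (4.9.4) p. 56; §12.5 p. 182
  (the Weyl integration formula's density `D_G(γ)²`); §12.7 Lemma 12.7.2 (proof) p. 193 («`D_G(γ) = ‖α‖⁻¹`» on the split torus).
* [HarishChandra1999AdmissibleDistributions] Harish-Chandra (notes by S. DeBacker, P. J. Sally), *Admissible invariant distributions on reductive p-adic groups*, AMS ULS 16 (1999):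
  §17 (`D_G` as the `t^ℓ`-coefficient of `det(t − Ad(x) + 1)`), Part III §16 Thm. 16.3.
* [WeilBNT1967] A. Weil, *Basic Number Theory* (1967), Ch. I §2 (modules of finite products).
-/

set_option autoImplicit false
-- the mandated namespace has the single-problem summit's repeated segment (`HodgeConjecture.HodgeConjecture`)
set_option linter.dupNamespace false

noncomputable section

open MeasureTheory Filter Topology Polynomial
open NumberField IsDedekindDomain
open scoped NNReal Matrix MatrixGroups
open Literature.NumberTheory.Automorphic Literature.NumberTheory.Automorphic.UnitaryGroup
open Literature.NumberTheory.GaloisRepresentations Literature.NumberTheory.GaloisRepresentations.IsNonarchimedeanLocalField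
open Literature.NumberTheory.Rogawski1990 Literature.NumberTheory.Rogawski1990.Ch12Sec5

namespace Summit.HodgeConjecture.HodgeConjecture.Cruxes.H413.F0P3cStCharTSDGField

open F0P3cStCharTSTorusDefs

variable (L : Type) [Field L] [NumberField L] [IsCMField L] (v : HeightOneSpectrum (𝓞 ↥(maximalRealSubfield L)))

/-! ## §0 `R = Π_{w∣v} L_w`: a unit has all components non-zero, a non-unit has a vanishing component -/

omit [IsCMField L] in
/-- Every component of a unit of `R = Π_w L_w` is non-zero. [cite: WeilBNT1967, Ch. I §2] -/
theorem apply_ne_zero_of_isUnit {x : UnitaryGroup.LocalRing L v} (hx : IsUnit x) (w : PlacesOver L v) : x w ≠ 0 :=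
  ((Pi.isUnit_iff.1 hx) w).ne_zero

omit [IsCMField L] in
/-- A non-unit of `R = Π_w L_w` has a vanishing component. [cite: WeilBNT1967, Ch. I §2] -/
theorem exists_apply_eq_zero_of_not_isUnit {x : UnitaryGroup.LocalRing L v} (hx : ¬ IsUnit x) : ∃ w : PlacesOver L v, x w = 0 := by
  by_contra h
  exact hx (Pi.isUnit_iff.2 fun w => isUnit_iff_ne_zero.2 fun h0 => h ⟨w, h0⟩)

/-! ## §1 The closed form `dg(g) = √√( N(discr(charpoly g)) · N(det g)⁻² )`, `N(x) = Π_w |x_w|_w`: continuity, value at the HC antecedent, vanishing off `G^r` -/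

/-- **Continuity of the closed form** on `U(Φ₃)(L⁺_v)`: the coefficients of `charpoly g` are polynomial in the entries (★ `continuous_charpoly_coeff`), the discriminant of the
(monic, cubic) characteristic polynomial is a polynomial in them (Mathlib `discr_of_degree_eq_three`), `det` is continuous, each `|·|_w` is continuous (★ `continuous_normAbs`), and
`N(det g) ≠ 0` (`det g` is a unit). [cite: Rogawski1990, §4.9 p. 54; §12.5 p. 182] -/
theorem continuous_dgFormula :
    Continuous fun g : Gqs L v =>
      ((NNReal.sqrt (NNReal.sqrt
        ((∏ w : PlacesOver L v, normAbs (w.1.adicCompletion L) (((g.val : GL (Fin 3) (UnitaryGroup.LocalRing L v)).val.charpoly.discr) w)) *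
          ((∏ w : PlacesOver L v, normAbs (w.1.adicCompletion L) (((g.val : GL (Fin 3) (UnitaryGroup.LocalRing L v)).val.det) w)) ^ 2)⁻¹)) : ℝ≥0) : ℝ) := by
  have hM : Continuous fun g : Gqs L v => ((g.val : GL (Fin 3) (UnitaryGroup.LocalRing L v)).val : Matrix (Fin 3) (Fin 3) (UnitaryGroup.LocalRing L v)) :=
    Units.continuous_val.comp continuous_subtype_val
  have hc : ∀ i : ℕ, Continuous fun g : Gqs L v => ((g.val : GL (Fin 3) (UnitaryGroup.LocalRing L v)).val.charpoly.coeff i) :=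
    fun i => (Literature.LinearAlgebra.Matrix.continuous_charpoly_coeff i).comp hM
  -- `discr (charpoly g)` as a polynomial in the coefficients (degree `3`)
  have hdisc : Continuous fun g : Gqs L v => (g.val : GL (Fin 3) (UnitaryGroup.LocalRing L v)).val.charpoly.discr := by
    have heq : (fun g : Gqs L v => (g.val : GL (Fin 3) (UnitaryGroup.LocalRing L v)).val.charpoly.discr) = fun g : Gqs L v =>
        (g.val : GL (Fin 3) (UnitaryGroup.LocalRing L v)).val.charpoly.coeff 2 ^ 2 * (g.val : GL (Fin 3) (UnitaryGroup.LocalRing L v)).val.charpoly.coeff 1 ^ 2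
          - 4 * (g.val : GL (Fin 3) (UnitaryGroup.LocalRing L v)).val.charpoly.coeff 3 * (g.val : GL (Fin 3) (UnitaryGroup.LocalRing L v)).val.charpoly.coeff 1 ^ 3
          - 4 * (g.val : GL (Fin 3) (UnitaryGroup.LocalRing L v)).val.charpoly.coeff 2 ^ 3 * (g.val : GL (Fin 3) (UnitaryGroup.LocalRing L v)).val.charpoly.coeff 0
          - 27 * (g.val : GL (Fin 3) (UnitaryGroup.LocalRing L v)).val.charpoly.coeff 3 ^ 2 * (g.val : GL (Fin 3) (UnitaryGroup.LocalRing L v)).val.charpoly.coeff 0 ^ 2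
          + 18 * (g.val : GL (Fin 3) (UnitaryGroup.LocalRing L v)).val.charpoly.coeff 3 * (g.val : GL (Fin 3) (UnitaryGroup.LocalRing L v)).val.charpoly.coeff 2 *
              (g.val : GL (Fin 3) (UnitaryGroup.LocalRing L v)).val.charpoly.coeff 1 * (g.val : GL (Fin 3) (UnitaryGroup.LocalRing L v)).val.charpoly.coeff 0 := by
      funext g
      exact discr_of_degree_eq_three (by rw [Matrix.charpoly_degree_eq_dim]; rfl)
    rw [heq]
    fun_prop
  have hdet : Continuous fun g : Gqs L v => (g.val : GL (Fin 3) (UnitaryGroup.LocalRing L v)).val.det :=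
    (continuous_id.matrix_det).comp hM
  have h1 : Continuous fun g : Gqs L v =>
      ∏ w : PlacesOver L v, normAbs (w.1.adicCompletion L) (((g.val : GL (Fin 3) (UnitaryGroup.LocalRing L v)).val.charpoly.discr) w) :=
    continuous_finsetProd _ fun w _ => LocalFieldHaar.continuous_normAbs.comp ((continuous_apply w).comp hdisc)
  have h2 : Continuous fun g : Gqs L v =>
      ∏ w : PlacesOver L v, normAbs (w.1.adicCompletion L) (((g.val : GL (Fin 3) (UnitaryGroup.LocalRing L v)).val.det) w) :=
    continuous_finsetProd _ fun w _ => LocalFieldHaar.continuous_normAbs.comp ((continuous_apply w).comp hdet)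
  have h2' : ∀ g : Gqs L v, (∏ w : PlacesOver L v, normAbs (w.1.adicCompletion L) (((g.val : GL (Fin 3) (UnitaryGroup.LocalRing L v)).val.det) w)) ^ 2 ≠ 0 :=
    fun g => pow_ne_zero 2 (Finset.prod_ne_zero_iff.2 fun w _ => (_root_.map_ne_zero _).2
      (apply_ne_zero_of_isUnit L v (Matrix.isUnits_det_units (g.val : GL (Fin 3) (UnitaryGroup.LocalRing L v))) w))
  exact NNReal.continuous_coe.comp (NNReal.continuous_sqrt.comp (NNReal.continuous_sqrt.comp (h1.mul ((h2.pow 2).inv₀ h2'))))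

/-- **Value at the Harish-Chandra antecedent.**  If `u·det(g)² = discr(charpoly g)` for a unit `u`, then `N(discr)·N(det)⁻² = N(u) = ‖u‖` (★ `unitModulusChar_localRing_eq_prod`), so
the closed form equals `√√‖u‖` — the weight of ★ `normalizedCharacter_locallyBounded`. [cite: Rogawski1990, §4.9 p. 54] [cite: HarishChandra1999AdmissibleDistributions, §17] -/
theorem dgFormula_eq_of_unit_rel (g : Gqs L v) (u : (UnitaryGroup.LocalRing L v)ˣ)
    (hu : (u : UnitaryGroup.LocalRing L v) * ((g.val : GL (Fin 3) (UnitaryGroup.LocalRing L v)).val.det) ^ (3 - 1) =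
      ((g.val : GL (Fin 3) (UnitaryGroup.LocalRing L v)).val.charpoly).discr) :
    ((NNReal.sqrt (NNReal.sqrt
        ((∏ w : PlacesOver L v, normAbs (w.1.adicCompletion L) (((g.val : GL (Fin 3) (UnitaryGroup.LocalRing L v)).val.charpoly.discr) w)) *
          ((∏ w : PlacesOver L v, normAbs (w.1.adicCompletion L) (((g.val : GL (Fin 3) (UnitaryGroup.LocalRing L v)).val.det) w)) ^ 2)⁻¹)) : ℝ≥0) : ℝ) =
      ((NNReal.sqrt (NNReal.sqrt (unitModulusChar (UnitaryGroup.LocalRing L v) u)) : ℝ≥0) : ℝ) := by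
  have hd : (∏ w : PlacesOver L v, normAbs (w.1.adicCompletion L) (((g.val : GL (Fin 3) (UnitaryGroup.LocalRing L v)).val.det) w)) ^ 2 ≠ 0 :=
    pow_ne_zero 2 (Finset.prod_ne_zero_iff.2 fun w _ => (_root_.map_ne_zero _).2
      (apply_ne_zero_of_isUnit L v (Matrix.isUnits_det_units (g.val : GL (Fin 3) (UnitaryGroup.LocalRing L v))) w))
  have hprod : (∏ w : PlacesOver L v, normAbs (w.1.adicCompletion L) (((g.val : GL (Fin 3) (UnitaryGroup.LocalRing L v)).val.charpoly.discr) w)) =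
      (∏ w : PlacesOver L v, normAbs (w.1.adicCompletion L) ((u : UnitaryGroup.LocalRing L v) w)) *
        (∏ w : PlacesOver L v, normAbs (w.1.adicCompletion L) (((g.val : GL (Fin 3) (UnitaryGroup.LocalRing L v)).val.det) w)) ^ 2 := by
    rw [← hu, ← Finset.prod_pow, ← Finset.prod_mul_distrib]
    refine Finset.prod_congr rfl fun w _ => ?_
    rw [Pi.mul_apply, Pi.pow_apply, map_mul, map_pow]
  congr 3
  rw [hprod, mul_inv_cancel_right₀ hd, unitModulusChar_localRing_eq_prod L v u]

/-- **Vanishing off `G^r`.**  If `discr(charpoly g)` is NOT a unit of `R` (⇔ `g` not regular), some component `discr_w` vanishes, so `N(discr) = 0` and the closed form is `0` —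
PLAN S9 D5's convention. [cite: Rogawski1990, §12.5 p. 182] -/
theorem dgFormula_eq_zero_of_not_isUnit_discr (g : Gqs L v)
    (h : ¬ IsUnit ((g.val : GL (Fin 3) (UnitaryGroup.LocalRing L v)).val.charpoly.discr)) :
    ((NNReal.sqrt (NNReal.sqrt
        ((∏ w : PlacesOver L v, normAbs (w.1.adicCompletion L) (((g.val : GL (Fin 3) (UnitaryGroup.LocalRing L v)).val.charpoly.discr) w)) *
          ((∏ w : PlacesOver L v, normAbs (w.1.adicCompletion L) (((g.val : GL (Fin 3) (UnitaryGroup.LocalRing L v)).val.det) w)) ^ 2)⁻¹)) : ℝ≥0) : ℝ) = 0 := by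
  obtain ⟨w, hw⟩ := exists_apply_eq_zero_of_not_isUnit L v h
  rw [Finset.prod_eq_zero (Finset.mem_univ w) (by rw [hw, map_zero]), zero_mul, NNReal.sqrt_zero, NNReal.sqrt_zero, NNReal.coe_zero]

/-- **The HC antecedent is inhabited iff the discriminant is a unit**: `(∃ u, u·det(g)² = discr) ↔ IsUnit discr` (`det g` is a unit; `u := discr·det⁻²`).
[cite: HarishChandra1999AdmissibleDistributions, §17] [cite: Rogawski1990, §4.9 p. 54] -/
theorem exists_unit_rel_iff_isUnit_discr (g : Gqs L v) :
    (∃ u : (UnitaryGroup.LocalRing L v)ˣ, (u : UnitaryGroup.LocalRing L v) * ((g.val : GL (Fin 3) (UnitaryGroup.LocalRing L v)).val.det) ^ (3 - 1) =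
        ((g.val : GL (Fin 3) (UnitaryGroup.LocalRing L v)).val.charpoly).discr) ↔
      IsUnit ((g.val : GL (Fin 3) (UnitaryGroup.LocalRing L v)).val.charpoly.discr) := by
  have hdet : IsUnit ((g.val : GL (Fin 3) (UnitaryGroup.LocalRing L v)).val.det) := Matrix.isUnits_det_units _
  constructor
  · rintro ⟨u, hu⟩
    rw [← hu]
    exact u.isUnit.mul (hdet.pow _)
  · intro hdisc
    obtain ⟨d, hd⟩ := hdet
    obtain ⟨e, he⟩ := hdisc
    refine ⟨e * (d ^ (3 - 1))⁻¹, ?_⟩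
    rw [← hd, ← he, ← Units.val_pow_eq_pow_val, ← Units.val_mul, inv_mul_cancel_right]

/-! ## §2 The ∃-FIELD in the map owner's text: `∃ DG, measurable ∧ (non-unit discr ⇒ 0) ∧ (HC antecedent ⇒ √√‖u‖)` -/

/-- **«DG-FIELD★» — THE ∃-FIELD `D_G` FOR THE §12.5 DATUM ON `U(Φ₃)(L⁺_v)`** (any finite place `v`): there is `DG : U(Φ₃)(L⁺_v) → ℝ`, MEASURABLE, vanishing wherever the
discriminant of the characteristic polynomial is a non-unit (= off `G^r`), and equal to `√√‖u‖ = |D_G(g)|_{L⁺_v}^{1∕2}` whenever `u·det(g)² = discr(charpoly g)` — the weight of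
★ `normalizedCharacter_locallyBounded`; witness: the closed form of §1.  Consumers: the `hDGm`∕`hDG` binders of ★ `F0P3cStCharTSL2dOfHcb` ∕ ★ `F0P3cStCharTSDatumJunction` (at ANY
`cartanG`: equality gives the `≤`), the `hDGm`∕`hD5` binders of ★ `F0P3cStCharTSU2OfUpDom`, and print-exactness of `D_G` in `WeylIntegrationFormula`∕`innerG`∕Prop. 12.5.2∕12.6.1.
[cite: Rogawski1990, §4.9 p. 54; §12.5 p. 182] [cite: HarishChandra1999AdmissibleDistributions, §17] -/
theorem exists_DG_field [MeasurableSpace (Gqs L v)] [BorelSpace (Gqs L v)] :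
    ∃ DG : Gqs L v → ℝ, Measurable DG ∧
      (∀ γ : Gqs L v, ¬ IsUnit ((γ.val.val.charpoly).discr) → DG γ = 0) ∧
      ∀ (γ : Gqs L v) (u : (UnitaryGroup.LocalRing L v)ˣ),
        (u : UnitaryGroup.LocalRing L v) * (γ.val.val.det) ^ (3 - 1) = (γ.val.val.charpoly).discr →
          DG γ = ((NNReal.sqrt (NNReal.sqrt (unitModulusChar (UnitaryGroup.LocalRing L v) u)) : ℝ≥0) : ℝ) :=
  ⟨fun g => ((NNReal.sqrt (NNReal.sqrt
        ((∏ w : PlacesOver L v, normAbs (w.1.adicCompletion L) (((g.val : GL (Fin 3) (UnitaryGroup.LocalRing L v)).val.charpoly.discr) w)) *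
          ((∏ w : PlacesOver L v, normAbs (w.1.adicCompletion L) (((g.val : GL (Fin 3) (UnitaryGroup.LocalRing L v)).val.det) w)) ^ 2)⁻¹)) : ℝ≥0) : ℝ),
    (continuous_dgFormula L v).measurable,
    fun γ h => dgFormula_eq_zero_of_not_isUnit_discr L v γ h,
    fun γ u hu => dgFormula_eq_of_unit_rel L v γ u hu⟩

/-! ## §3 At a datum with the field equation `hDG : 𝔇.DG = dg`: measurability, the S13a junction `hD5`, the S9c disjunction `hDG`, non-negativity, and `D_G ∘ ι = Re Δ` on the split torus -/

section Datum

variable {H : Type} [Group H] [TopologicalSpace H] [IsTopologicalGroup H] [MeasurableSpace H]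

/-- **`𝔇.DG` is measurable** (indeed continuous) under the field equation — the `hDGm` hypothesis of ★ S9c `l2CharOnTorusAll_of_hcBounded` and ★ S13a `l2UpOnTorus_of_upDom`.
[cite: Rogawski1990, §12.5 p. 182; §4.9 p. 54] -/
theorem measurable_DG
    [MeasurableSpace (Gqs L v)] [BorelSpace (Gqs L v)]
    [∀ γ : Gqs L v, MeasurableSpace (Gqs L v ⧸ Subgroup.centralizer ({γ} : Set (Gqs L v)))] [MeasurableSpace (Gqs L v ⧸ Subgroup.center (Gqs L v))]
    (𝔇 : EllipticData (Gqs L v) H)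
    (hDG : ∀ g : Gqs L v, 𝔇.DG g =
      ((NNReal.sqrt (NNReal.sqrt
        ((∏ w : PlacesOver L v, normAbs (w.1.adicCompletion L) (((g.val : GL (Fin 3) (UnitaryGroup.LocalRing L v)).val.charpoly.discr) w)) *
          ((∏ w : PlacesOver L v, normAbs (w.1.adicCompletion L) (((g.val : GL (Fin 3) (UnitaryGroup.LocalRing L v)).val.det) w)) ^ 2)⁻¹)) : ℝ≥0) : ℝ)) :
    Measurable 𝔇.DG := by
  rw [show 𝔇.DG = _ from funext hDG]
  exact (continuous_dgFormula L v).measurable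

/-- **S13a's `hD5` as a theorem**: under the field equation, `u·det(g)² = discr(charpoly g)` forces `𝔇.DG g = √√‖u‖` (§1). [cite: Rogawski1990, §4.9 p. 54] [cite: HarishChandra1999AdmissibleDistributions, §17] -/
theorem DG_eq_of_unit_rel
    [MeasurableSpace (Gqs L v)]
    [∀ γ : Gqs L v, MeasurableSpace (Gqs L v ⧸ Subgroup.centralizer ({γ} : Set (Gqs L v)))] [MeasurableSpace (Gqs L v ⧸ Subgroup.center (Gqs L v))]
    (𝔇 : EllipticData (Gqs L v) H)
    (hDG : ∀ g : Gqs L v, 𝔇.DG g =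
      ((NNReal.sqrt (NNReal.sqrt
        ((∏ w : PlacesOver L v, normAbs (w.1.adicCompletion L) (((g.val : GL (Fin 3) (UnitaryGroup.LocalRing L v)).val.charpoly.discr) w)) *
          ((∏ w : PlacesOver L v, normAbs (w.1.adicCompletion L) (((g.val : GL (Fin 3) (UnitaryGroup.LocalRing L v)).val.det) w)) ^ 2)⁻¹)) : ℝ≥0) : ℝ)) :
    ∀ (g : Gqs L v) (u : (UnitaryGroup.LocalRing L v)ˣ),
      (u : UnitaryGroup.LocalRing L v) * ((g.val : GL (Fin 3) (UnitaryGroup.LocalRing L v)).val.det) ^ (3 - 1) =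
          ((g.val : GL (Fin 3) (UnitaryGroup.LocalRing L v)).val.charpoly).discr →
        𝔇.DG g = ((NNReal.sqrt (NNReal.sqrt (unitModulusChar (UnitaryGroup.LocalRing L v) u)) : ℝ≥0) : ℝ) :=
  fun g u hu => by rw [hDG g]; exact dgFormula_eq_of_unit_rel L v g u hu

/-- **S13a's `hD5` in its split-torus spelling** (the binder text of ★ `hcbUp_of_upDom`): for `t ∈ M`, `u·det(ι t)² = discr(charpoly (ι t)) → 𝔇.DG (ι t) = √√‖u‖`.
[cite: Rogawski1990, §4.9 p. 54; §12.7 Lemma 12.7.2 (proof) p. 193] -/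
theorem DG_coe_torus_eq_of_unit_rel
    [MeasurableSpace (Gqs L v)]
    [∀ γ : Gqs L v, MeasurableSpace (Gqs L v ⧸ Subgroup.centralizer ({γ} : Set (Gqs L v)))] [MeasurableSpace (Gqs L v ⧸ Subgroup.center (Gqs L v))]
    (𝔇 : EllipticData (Gqs L v) H)
    (hDG : ∀ g : Gqs L v, 𝔇.DG g =
      ((NNReal.sqrt (NNReal.sqrt
        ((∏ w : PlacesOver L v, normAbs (w.1.adicCompletion L) (((g.val : GL (Fin 3) (UnitaryGroup.LocalRing L v)).val.charpoly.discr) w)) *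
          ((∏ w : PlacesOver L v, normAbs (w.1.adicCompletion L) (((g.val : GL (Fin 3) (UnitaryGroup.LocalRing L v)).val.det) w)) ^ 2)⁻¹)) : ℝ≥0) : ℝ)) :
    ∀ (t : ↥(cmBorelTriple L 3 v).M) (u : (UnitaryGroup.LocalRing L v)ˣ),
      (u : UnitaryGroup.LocalRing L v) *
          ((((t : ↥(unitaryGroupOfForm (conjLocal L (IsCMField.complexConj L) v) (cmLocalForm L 3 v))) : Gqs L v).val : GL (Fin 3) (UnitaryGroup.LocalRing L v)).val.det) ^ (3 - 1) =
        ((((t : ↥(unitaryGroupOfForm (conjLocal L (IsCMField.complexConj L) v) (cmLocalForm L 3 v))) : Gqs L v).val : GL (Fin 3) (UnitaryGroup.LocalRing L v)).val.charpoly).discr →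
      𝔇.DG ((t : ↥(unitaryGroupOfForm (conjLocal L (IsCMField.complexConj L) v) (cmLocalForm L 3 v))) : Gqs L v) =
        ((NNReal.sqrt (NNReal.sqrt (unitModulusChar (UnitaryGroup.LocalRing L v) u)) : ℝ≥0) : ℝ) :=
  fun t u hu => DG_eq_of_unit_rel L v 𝔇 hDG ((t : ↥(unitaryGroupOfForm (conjLocal L (IsCMField.complexConj L) v) (cmLocalForm L 3 v))) : Gqs L v) u hu

/-- **The pointwise dichotomy**: under the field equation, EVERY `g` has `𝔇.DG g = 0` or carries a unit `u` with `u·det(g)² = discr(charpoly g)` and `𝔇.DG g = √√‖u‖`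
(unit discriminant: `u := discr·det⁻²`; non-unit discriminant: a component of `discr` vanishes). [cite: Rogawski1990, §12.5 p. 182; §4.9 p. 54] -/
theorem DG_eq_zero_or_exists_unit
    [MeasurableSpace (Gqs L v)]
    [∀ γ : Gqs L v, MeasurableSpace (Gqs L v ⧸ Subgroup.centralizer ({γ} : Set (Gqs L v)))] [MeasurableSpace (Gqs L v ⧸ Subgroup.center (Gqs L v))]
    (𝔇 : EllipticData (Gqs L v) H)
    (hDG : ∀ g : Gqs L v, 𝔇.DG g =
      ((NNReal.sqrt (NNReal.sqrt
        ((∏ w : PlacesOver L v, normAbs (w.1.adicCompletion L) (((g.val : GL (Fin 3) (UnitaryGroup.LocalRing L v)).val.charpoly.discr) w)) *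
          ((∏ w : PlacesOver L v, normAbs (w.1.adicCompletion L) (((g.val : GL (Fin 3) (UnitaryGroup.LocalRing L v)).val.det) w)) ^ 2)⁻¹)) : ℝ≥0) : ℝ))
    (g : Gqs L v) :
    𝔇.DG g = 0 ∨ ∃ u : (UnitaryGroup.LocalRing L v)ˣ,
      (u : UnitaryGroup.LocalRing L v) * ((g.val : GL (Fin 3) (UnitaryGroup.LocalRing L v)).val.det) ^ (3 - 1) =
          ((g.val : GL (Fin 3) (UnitaryGroup.LocalRing L v)).val.charpoly).discr ∧
        𝔇.DG g = ((NNReal.sqrt (NNReal.sqrt (unitModulusChar (UnitaryGroup.LocalRing L v) u)) : ℝ≥0) : ℝ) := by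
  by_cases h : IsUnit ((g.val : GL (Fin 3) (UnitaryGroup.LocalRing L v)).val.charpoly.discr)
  · obtain ⟨u, hu⟩ := (exists_unit_rel_iff_isUnit_discr L v g).2 h
    exact Or.inr ⟨u, hu, DG_eq_of_unit_rel L v 𝔇 hDG g u hu⟩
  · exact Or.inl (by rw [hDG g]; exact dgFormula_eq_zero_of_not_isUnit_discr L v g h)

/-- **S9c's `hDG` as a theorem** (the binder text of ★ `l2CharOnTorusAll_of_hcBounded` ∕ `l2dEll_of_hcBounded`, and of the junction): on every `T ∈ cartanG` and every `t ∈ T`,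
`𝔇.DG t = 0` or `|𝔇.DG t| ≤ √√‖u‖` for a unit `u` with `u·det(t)² = discr(charpoly t)` (indeed `=`). [cite: Rogawski1990, §12.5 pp. 182, 184; §4.9 p. 54] -/
theorem DG_eq_zero_or_le
    [MeasurableSpace (Gqs L v)]
    [∀ γ : Gqs L v, MeasurableSpace (Gqs L v ⧸ Subgroup.centralizer ({γ} : Set (Gqs L v)))] [MeasurableSpace (Gqs L v ⧸ Subgroup.center (Gqs L v))]
    (𝔇 : EllipticData (Gqs L v) H)
    (hDG : ∀ g : Gqs L v, 𝔇.DG g =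
      ((NNReal.sqrt (NNReal.sqrt
        ((∏ w : PlacesOver L v, normAbs (w.1.adicCompletion L) (((g.val : GL (Fin 3) (UnitaryGroup.LocalRing L v)).val.charpoly.discr) w)) *
          ((∏ w : PlacesOver L v, normAbs (w.1.adicCompletion L) (((g.val : GL (Fin 3) (UnitaryGroup.LocalRing L v)).val.det) w)) ^ 2)⁻¹)) : ℝ≥0) : ℝ)) :
    ∀ T ∈ 𝔇.cartanG, ∀ t : ↥T, 𝔇.DG (t : Gqs L v) = 0 ∨ ∃ u : (UnitaryGroup.LocalRing L v)ˣ,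
      (u : UnitaryGroup.LocalRing L v) * ((((t : Gqs L v)).val : GL (Fin 3) (UnitaryGroup.LocalRing L v)).val.det) ^ (3 - 1) =
          ((((t : Gqs L v)).val : GL (Fin 3) (UnitaryGroup.LocalRing L v)).val.charpoly).discr ∧
        |𝔇.DG (t : Gqs L v)| ≤ ((NNReal.sqrt (NNReal.sqrt (unitModulusChar (UnitaryGroup.LocalRing L v) u)) : ℝ≥0) : ℝ) := by
  intro T _ t
  rcases DG_eq_zero_or_exists_unit L v 𝔇 hDG (t : Gqs L v) with h0 | ⟨u, hu, hval⟩
  · exact Or.inl h0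
  · exact Or.inr ⟨u, hu, by rw [hval, abs_of_nonneg (NNReal.coe_nonneg _)]⟩

/-- **`0 ≤ 𝔇.DG`** under the field equation. [cite: Rogawski1990, §4.9 p. 54] -/
theorem DG_nonneg
    [MeasurableSpace (Gqs L v)]
    [∀ γ : Gqs L v, MeasurableSpace (Gqs L v ⧸ Subgroup.centralizer ({γ} : Set (Gqs L v)))] [MeasurableSpace (Gqs L v ⧸ Subgroup.center (Gqs L v))]
    (𝔇 : EllipticData (Gqs L v) H)
    (hDG : ∀ g : Gqs L v, 𝔇.DG g =
      ((NNReal.sqrt (NNReal.sqrt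
        ((∏ w : PlacesOver L v, normAbs (w.1.adicCompletion L) (((g.val : GL (Fin 3) (UnitaryGroup.LocalRing L v)).val.charpoly.discr) w)) *
          ((∏ w : PlacesOver L v, normAbs (w.1.adicCompletion L) (((g.val : GL (Fin 3) (UnitaryGroup.LocalRing L v)).val.det) w)) ^ 2)⁻¹)) : ℝ≥0) : ℝ))
    (g : Gqs L v) : 0 ≤ 𝔇.DG g := by
  rw [hDG g]; exact NNReal.coe_nonneg _

/-- **THE TORUS JUNCTION `D_G ∘ ι = Re Δ` ON ALL OF `M`** (`v` NON-SPLIT): under the field equation, for EVERY `t` in the split torus, `𝔇.DG (ι t) = Re Δ(t)` — at regular `t` both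
equal `√√‖u‖` (★ VDW-CORE `coe_sqrt_sqrt_unitModulusChar_eq_vanDijkWeight_re`, ★ `exists_unit_mul_det_sq_eq_discr_iff`), at singular `t` both vanish (★ `vanDijkWeight_eq_zero_of_not`,
§1).  This is the bridge between the Weyl-integration density `D_G` of `WeylIntegrationFormula`∕`innerG` at `T = M` and the density `Δ ∘ ι` of the (TOR) blocks (★ SaHeadTorus₆…₁₀).
[cite: Rogawski1990, §12.7 Lemma 12.7.2 (proof) p. 193; §4.9 (4.9.4) p. 56; §12.5 p. 182] -/
theorem DG_coe_torus_eq_vanDijkWeight_re (hns : ∀ w : PlacesOver L v, IsCMField.complexConj L • w.1 = w.1)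
    [MeasurableSpace (Gqs L v)]
    [∀ γ : Gqs L v, MeasurableSpace (Gqs L v ⧸ Subgroup.centralizer ({γ} : Set (Gqs L v)))] [MeasurableSpace (Gqs L v ⧸ Subgroup.center (Gqs L v))]
    (𝔇 : EllipticData (Gqs L v) H)
    (hDG : ∀ g : Gqs L v, 𝔇.DG g =
      ((NNReal.sqrt (NNReal.sqrt
        ((∏ w : PlacesOver L v, normAbs (w.1.adicCompletion L) (((g.val : GL (Fin 3) (UnitaryGroup.LocalRing L v)).val.charpoly.discr) w)) *
          ((∏ w : PlacesOver L v, normAbs (w.1.adicCompletion L) (((g.val : GL (Fin 3) (UnitaryGroup.LocalRing L v)).val.det) w)) ^ 2)⁻¹)) : ℝ≥0) : ℝ))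
    (t : ↥(cmBorelTriple L 3 v).M) :
    𝔇.DG ((t : ↥(unitaryGroupOfForm (conjLocal L (IsCMField.complexConj L) v) (cmLocalForm L 3 v))) : Gqs L v) = (vanDijkWeight L v t).re := by
  rcases Classical.em (IsUnit ((((torusEntry (conjLocal L (IsCMField.complexConj L) v) (cmLocalForm L 3 v) 0 t)⁻¹ *
        torusEntry (conjLocal L (IsCMField.complexConj L) v) (cmLocalForm L 3 v) 1 t : (UnitaryGroup.LocalRing L v)ˣ) : UnitaryGroup.LocalRing L v) - 1) ∧
      IsUnit ((((torusEntry (conjLocal L (IsCMField.complexConj L) v) (cmLocalForm L 3 v) 0 t)⁻¹ *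
        torusEntry (conjLocal L (IsCMField.complexConj L) v) (cmLocalForm L 3 v) 2 t : (UnitaryGroup.LocalRing L v)ˣ) : UnitaryGroup.LocalRing L v) - 1)) with hreg | hreg
  · obtain ⟨u, hu⟩ := (F0P3cStCharTSVanDijkHC.exists_unit_mul_det_sq_eq_discr_iff L v hns t).2 hreg
    rw [DG_eq_of_unit_rel L v 𝔇 hDG _ u hu]
    exact F0P3cStCharTSVanDijkHC.coe_sqrt_sqrt_unitModulusChar_eq_vanDijkWeight_re L v hns t u hu
  · have h0 : ¬ IsUnit ((((t : ↥(unitaryGroupOfForm (conjLocal L (IsCMField.complexConj L) v) (cmLocalForm L 3 v))) : Gqs L v).val :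
        GL (Fin 3) (UnitaryGroup.LocalRing L v)).val.charpoly.discr) := fun hdisc =>
      hreg ((F0P3cStCharTSVanDijkHC.exists_unit_mul_det_sq_eq_discr_iff L v hns t).1 ((exists_unit_rel_iff_isUnit_discr L v _).2 hdisc))
    rw [F0P3cStCharTSVanDijkWeylSymm.vanDijkWeight_eq_zero_of_not L v t hreg, Complex.zero_re, hDG]
    exact dgFormula_eq_zero_of_not_isUnit_discr L v _ h0

end Datum

end Summit.HodgeConjecture.HodgeConjecture.Cruxes.H413.F0P3cStCharTSDGField

end
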